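import Literature.AlgebraicGeometry.Resolution.OrderReductionThreefoldsAlgClosed
import Literature.AlgebraicGeometry.Resolution.IdealisticExponentResolution
import HarnessLib

/-!
# F-71ᴱ — the boundary-aware residual of the W-level engine of line `giraud-weak-normal-form` (TYPED STATEMENT ONLY; OURS; counted 0)

Unit res-B-lens-2 gen 5 (planner), crux `stmt-ResolutionOfSingularities-0549` (`Theses.Descent.DescentPerfectToAll`),
line `giraud-weak-normal-form`, census `Lines/giraud-weak-normal-form-JCJS-census.md` rev 2.2 §8.3, P2dim4 M14.
bears_on: LADDER-RESOLUTION:B · [OURS · CANDIDATE] counted 0; nothing here proves resolution in char p.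
**Resolution of singularities in positive characteristic is NOT proved here or anywhere in this line.**
Label: de-risking scaffolding for the type-N / `ν < p` branch of `stub_weakNormalFormSep_dimGtThree`, NOT rung-B progress.

WHAT THIS FILE IS. After the g5 CORRECTION the W-level engine that OSP-5 (dim 4, type N, `0 < ν < p`) consumes splits as
F-71 (the KERNEL THEOREM `Summit.ResolutionOfSingularities.ResolutionOfSingularities.Theorems.CP2008Prop44.cossartPiltant2008_prop44_holds :
Literature.AlgebraicGeometry.Resolution.CossartPiltant2008_prop44` — boundary-free `(J, μ)` order reduction on regular excellent threefolds,
`V(J)` of codimension `≥ 2`) + F-71ᴱ (centres snc-transversal to a given boundary and the boundary updated) + BK-1 (cosupport adapter).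
This file TYPES F-71ᴱ, in the tree's BGMW marked-ideal currency (`MarkedIdeal ⟨I, E, r⟩`, `IsMultipleBlowup` = blow-ups with regular
centre inside the support having snc with the boundary, boundary and controlled transform updated; `IsMarkedResolution` = ending with empty
support), as the named fact `Cutkosky2009_thm_5_6` of `OrderReductionThreefoldsAlgClosed.lean` with its binders «`k` algebraically closed,
`V ↪ ℙⁿ_k` a variety» REPLACED by «`V` an integral Noetherian regular excellent scheme of dimension 3» — i.e. arbitrary (imperfect) residue
fields, as the maximal-contact threefold `W` of the (f,E)-game requires. Nothing is asserted: `MarkedOrderReductionExcellentThreefolds` is a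
`Prop`; the two theorems below are the trivial case (non-vacuity of the conclusion shape) and the specialisation of the binders to the shape a
consumer meets. NOTE (BK-1): unlike F-71 there is NO codimension hypothesis on `V(I)` here — this is Cutkosky's form (his Thm. 6.1 handles
surfaces in `Sing_r`), so F-71ᴱ as typed INCLUDES the cosupport adapter BK-1 of the census.

SCOPE REMARK (crit-1 TRIAGE 28 F1, accepted): «regular excellent of dimension 3» INCLUDES mixed characteristic; the (f,E)-game's consumer `W` is
EQUICHARACTERISTIC `p` (essentially of finite type over a field `K` of characteristic `p`), where F-71 + [CossartPiltant2008] / CJS suffice; the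
mixed-characteristic instances of this Prop would drag in CP2019's arithmetic case and are NOT needed by the line — a prover may add the binder
`CharP`/«`V` over `Spec 𝔽_p`» to get the minimal target. MAX-ORDER REMARK (crit-1 TRIAGE 24 ADDENDUM): like `Cutkosky2009_thm_5_6` and F-71 this
is MAX-order reduction (`ν_x(I) ≤ r` everywhere); the marked W-object `(C|_W, N)` with `N <` max order is closed by ITERATING it plus a monomial
phase (census §8.3 (v)); the interface of those extra centres with the fourfold game is item (α) of P2dim4, real content.

PRINT STATUS (census §8): `k = k̄`: [Cutkosky2009, Thm. 5.6] (text of §§5–10 residue-field-free except the non-rational `τ = 1` near point,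
which is [CossartPiltant2008, Lemma 4.5 (2), (16)–(25)] in print and `Literature.AlgebraicGeometry.Resolution.exists_prepared_label_nonRationalStep`
in the tree); arbitrary excellent `V` WITH boundary: not found verbatim as one printed statement; expected size of a kernel proof: M (re-run the
W4.6 slices of F-71 with the snc constraint, plus [Cutkosky2009, §§6–8] bookkeeping), possibly L because of BK-1(b). HONEST STATUS: AI-written,
weaker than expert review; a typed target, not a result.
[cite: Cutkosky2009, Thm. 5.6, Def. 5.4, Def. 5.5] [cite: CossartPiltant2008, Prop. 4.4, Lemma 4.5] [cite: BierstoneGrigorievMilmanWlodarczyk2011, Def. 3.1.1–3.1.3]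
-/

-- `Summit.<Summit>.<Sub>.…` with `Sub = Summit` (single-conjunct summit, D-0017)
set_option linter.dupNamespace false

noncomputable section

open CategoryTheory AlgebraicGeometry TopologicalSpace

namespace Summit.ResolutionOfSingularities.ResolutionOfSingularities.Cruxes.DescentPerfectToAll.GiraudWeakNormalForm

open Literature.AlgebraicGeometry.Resolution

universe u

/-- **F-71ᴱ (typed; OURS; nothing asserted).** Order reduction of a marked ideal `(I, E, r)` WITH BOUNDARY on an integral Noetherian
regular excellent scheme `V` of dimension `3` (arbitrary residue fields): if `ν_x(I) ≤ r` everywhere and `r ≥ 1`, there is a multiple blow-up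
`π : V' → V` in the BGMW sense (regular centres inside the support, snc with the boundary, boundary and controlled transform updated) ending
with empty support, i.e. `ν(I') < r` everywhere. = `Cutkosky2009_thm_5_6` with «`k = k̄`, `V ↪ ℙⁿ_k`» replaced by «regular excellent».
[cite: Cutkosky2009, Thm. 5.6] [cite: CossartPiltant2008, Prop. 4.4] -/
def MarkedOrderReductionExcellentThreefolds : Prop :=
  ∀ (V : Scheme.{u}) [IsIntegral V] [IsNoetherian V], Scheme.IsRegular V → Scheme.IsExcellent V →
    topologicalKrullDim V = 3 →
    ∀ (E : List V.IdealSheafData), HasSNC E →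
    ∀ (I : V.IdealSheafData), I ≠ ⊥ → ∀ (r : ℕ), 1 ≤ r → (∀ x : V, idealOrder I x ≤ r) →
      ∃ (V' : Scheme.{u}) (π : V' ⟶ V) (R' : MarkedIdeal V'),
        IsMarkedResolution (⟨I, E, r⟩ : MarkedIdeal V) π R'

namespace MarkedOrderReductionExcellentThreefolds

variable {V : Scheme.{u}}

/-- The trivial case `ν_x(I) < r` everywhere: the identity is a marked resolution (same bookkeeping lemma as for the `k̄` named fact).
[cite: Kollar2007, remark after Thm. 3.69 (p. 150)] -/
theorem conclusion_of_forall_lt (I : V.IdealSheafData) (E : List V.IdealSheafData) {r : ℕ}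
    (h : ∀ x : V, idealOrder I x < r) :
    ∃ (V' : Scheme.{u}) (π : V' ⟶ V) (R' : MarkedIdeal V'),
      IsMarkedResolution (⟨I, E, r⟩ : MarkedIdeal V) π R' :=
  Cutkosky2009_thm_5_6.conclusion_of_forall_lt I E h

/-- CONSUMER SHAPE (what the (f,E)-game's W-level step instantiates): from F-71ᴱ, for ONE regular excellent integral Noetherian threefold `W`
with snc boundary `E_W` and a non-zero ideal `I_W` of maximal order `≤ r`, a boundary-aware order reduction below `r`. Pure specialisation of
the binders (no mathematics). [folklore] -/
theorem apply (hF : MarkedOrderReductionExcellentThreefolds.{u}) (W : Scheme.{u}) [IsIntegral W] [IsNoetherian W]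
    (hreg : Scheme.IsRegular W) (hexc : Scheme.IsExcellent W) (hdim : topologicalKrullDim W = 3)
    (E : List W.IdealSheafData) (hE : HasSNC E) (I : W.IdealSheafData) (hI : I ≠ ⊥) (r : ℕ) (hr : 1 ≤ r)
    (hle : ∀ x : W, idealOrder I x ≤ r) :
    ∃ (W' : Scheme.{u}) (π : W' ⟶ W) (R' : MarkedIdeal W'), IsMarkedResolution (⟨I, E, r⟩ : MarkedIdeal W) π R' :=
  hF W hreg hexc hdim E hE I hI r hr hle

end MarkedOrderReductionExcellentThreefolds

end Summit.ResolutionOfSingularities.ResolutionOfSingularities.Cruxes.DescentPerfectToAll.GiraudWeakNormalForm
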